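import Summits.Ventures.PercRepro.MSTightConjTAlpha
import Summits.Ventures.PercRepro.MSTightDefect
import Summits.Ventures.PercRepro.ThetaTwoPairsV2

/-!
# What Conjecture (T) gives for the non-monotone Case I of (SING-t)

Dossier proofs/MINE1-theoremS.md, Addendum 45 (supplement 3); the plan of Addenda 43 (4)–(5) and
44 made rigorous modulo `Y ⊆ X`. Setting: `r ∈ u`, `u₁ := u.erase r ∈ F` (Case I), and
`diffsY r F ⊆ diffsX r F` at `r`.
* **Every `r`-member is C*-signable for `u`** (`cells_compl_of_diffsY_subset`): the C*-cells of
  `t ∪ r` are `t ∖ u₁ ∈ Y ⊆ X` and `u₁ ∖ t ∈ F₀ ∖∖ F₁ ⊆ X`.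
* Hence, in an excess-one family with `u ∉ F` and `F ∪ {u}` not tight, **the member that is not
  C*-signable is an `r`-free member `s` with `u₁ ∖ s ∉ Y`**
  (`exists_part0_sdiff_notMem_diffsY_of_not_tight_insert`; `tight_insert_iff_of_excess_one`):
  `s ∖ u₁ ∈ F₀ ∖∖ F₀ ⊆ X` always, so the failing cell is `u ∖ s = (u₁ ∖ s) ∪ {r}`.
So under Conjecture (T) the non-monotone Case I of `SingNonMonotone` reduces to: *in a valid
residue instance at a genuine tight trace, every `r`-free member `s` has `u₁ ∖ s ∈ Y`* — the
count (c) of Addendum 43, the exact remaining piece (the candidate Prop `SingCaseIResidue α` of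
MSTightConjTSingCandidate.lean, which assembles `SingNonMonotone α` from it and `ConjT α`).
-/

namespace PercRepro.MSTight

open Finset
open scoped FinsetFamily

variable {α : Type*} [DecidableEq α] [Fintype α] {r : α} {F : Finset (Finset α)} {u : Finset α}

/-- The C*-cells of an `r`-member for `u ∋ r` are the `r`-free sets `t ∖ u₁` and `u₁ ∖ t`. -/
theorem cells_compl_iff_of_mem {t : Finset α} (hru : r ∈ u) (hrt : r ∉ t) :
    Cells (F \\ F) (insert r t) (univ \ u) ↔ t \ u.erase r ∈ F \\ F ∧ u.erase r \ t ∈ F \\ F := by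
  have e1 : insert r t ∩ (univ \ u) = t \ u.erase r := by
    ext x
    simp only [mem_inter, mem_insert, mem_sdiff, mem_univ, true_and, mem_erase]
    constructor
    · rintro ⟨h1 | h1, h2⟩
      · exact absurd (h1 ▸ hru) h2
      · exact ⟨h1, fun h => h2 h.2⟩
    · rintro ⟨h1, h2⟩
      refine ⟨Or.inr h1, fun hxu => h2 ⟨?_, hxu⟩⟩
      rintro rfl; exact hrt h1
  have e2 : (univ \ insert r t) ∩ (univ \ (univ \ u)) = u.erase r \ t := by
    ext x
    simp only [mem_inter, mem_sdiff, mem_univ, true_and, mem_insert, not_or, not_not, mem_erase]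
    tauto
  rw [Cells, e1, e2]

/-- **Under `Y ⊆ X`, every `r`-member is C*-signable for `u`** (Case I: `u.erase r ∈ F`, `r ∈ u`). -/
theorem cells_compl_of_diffsY_subset (hT : diffsY r F ⊆ diffsX r F) (hru : r ∈ u)
    (hu1 : u.erase r ∈ F) {t : Finset α} (ht : t ∈ partr r F) :
    Cells (F \\ F) (insert r t) (univ \ u) := by
  have hrt : r ∉ t := (mem_partr.1 ht).1
  have hu0 : u.erase r ∈ part0 r F := mem_part0.2 ⟨hu1, notMem_erase r u⟩
  rw [cells_compl_iff_of_mem hru hrt]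
  constructor
  · have h : t \ u.erase r ∈ diffsY r F := mem_diffs.2 ⟨t, ht, _, hu0, rfl⟩
    exact (mem_diffsX_iff.1 (hT h)).1
  · have h : u.erase r \ t ∈ diffsX r F :=
      mem_union.2 (Or.inr (mem_diffs.2 ⟨_, hu0, t, ht, rfl⟩))
    exact (mem_diffsX_iff.1 h).1

/-- **The non-C*-signable member is `r`-free, with `u₁ ∖ s ∉ Y`.** For an excess-one `F` with
`u ∉ F`, `F ∪ {u}` not tight, `r ∈ u`, `u.erase r ∈ F` and `Y ⊆ X` at `r`, some `s ∈ F₀` has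
`u.erase r ∖ s ∉ diffsY r F`. -/
theorem exists_part0_sdiff_notMem_diffsY_of_not_tight_insert (hF : (F \\ F).card = F.card + 1)
    (hu : u ∉ F) (hnt : ¬ Tight (insert u F)) (hru : r ∈ u) (hu1 : u.erase r ∈ F)
    (hT : diffsY r F ⊆ diffsX r F) :
    ∃ s ∈ part0 r F, u.erase r \ s ∉ diffsY r F := by
  rw [tight_insert_iff_of_excess_one hF hu] at hnt
  push Not at hnt
  obtain ⟨A, hA, hfail⟩ := hnt
  by_cases hrA : r ∈ A
  · -- an `r`-member is C*-signable: both its cells are differences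
    exfalso
    have ht : A.erase r ∈ partr r F := mem_partr.2 ⟨notMem_erase r A, by rwa [insert_erase hrA]⟩
    have hc := cells_compl_of_diffsY_subset hT hru hu1 ht
    rw [cells_compl_iff_of_mem hru (notMem_erase r A)] at hc
    have e1 : u \ A = u.erase r \ A.erase r := by
      ext x
      rw [mem_sdiff, mem_sdiff, mem_erase, mem_erase]
      constructor
      · rintro ⟨hxu, hxA⟩
        refine ⟨⟨?_, hxu⟩, fun h => hxA h.2⟩
        rintro rfl; exact hxA hrA
      · rintro ⟨⟨hxr, hxu⟩, h⟩
        exact ⟨hxu, fun hxA => h ⟨hxr, hxA⟩⟩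
    have e2 : A \ u = A.erase r \ u.erase r := by
      ext x
      rw [mem_sdiff, mem_sdiff, mem_erase, mem_erase]
      constructor
      · rintro ⟨hxA, hxu⟩
        refine ⟨⟨?_, hxA⟩, fun h => hxu h.2⟩
        rintro rfl; exact hxu hru
      · rintro ⟨⟨hxr, hxA⟩, h⟩
        exact ⟨hxA, fun hxu => h ⟨hxr, hxu⟩⟩
    exact hfail (e1 ▸ hc.2) (e2 ▸ hc.1)
  · -- an `r`-free member: `A ∖ u ∈ F₀ ∖∖ F₀` is a difference, so the failing cell is `u ∖ A`
    refine ⟨A, mem_part0.2 ⟨hA, hrA⟩, ?_⟩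
    intro hY
    apply hfail
    · have e : u \ A = insert r (u.erase r \ A) := by
        ext x
        rw [mem_sdiff, mem_insert, mem_sdiff, mem_erase]
        constructor
        · rintro ⟨hxu, hxA⟩
          by_cases hxr : x = r
          · exact Or.inl hxr
          · exact Or.inr ⟨⟨hxr, hxu⟩, hxA⟩
        · rintro (rfl | ⟨⟨_, hxu⟩, hxA⟩)
          · exact ⟨hru, hrA⟩
          · exact ⟨hxu, hxA⟩
      rw [e]
      exact (mem_diffsY_iff.1 hY).2
    · have e : A \ u = A \ u.erase r := by
        ext x
        rw [mem_sdiff, mem_sdiff, mem_erase]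
        constructor
        · rintro ⟨hxA, hxu⟩; exact ⟨hxA, fun h => hxu h.2⟩
        · rintro ⟨hxA, h⟩
          exact ⟨hxA, fun hxu => h ⟨fun e => hrA (e ▸ hxA), hxu⟩⟩
      rw [e]
      exact mem_diffs.2 ⟨A, hA, u.erase r, hu1, rfl⟩

end PercRepro.MSTight
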